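import Summits.AnomalousDissipation.AnomalousDissipation.Theorems.SolenoidalFractalHomogenisationLagrangianStepSidebandXSlowEquation
import Summits.AnomalousDissipation.AnomalousDissipation.Theorems.SolenoidalFractalHomogenisationLagrangianStepW7ThreeModeFibre
import Summits.AnomalousDissipation.AnomalousDissipation.Theorems.SolenoidalFractalHomogenisationLagrangianStepSidebandXEffGenDefs
import Literature.Analysis.FluidPDE.PassiveVectorTensorFourier
import HarnessLib

/-!
# K1L_D `LagrangianRenormalisationStepDesign` (stmt-AnomalousDissipation-27980), `stub_D1_V0R` (D27-1; V0 = clause (ii) of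
# `WCrossing.D1ExactFamily`), brick T7b: THE AUGMENTED EFFECTIVE SLOW GENERATOR `effGenC 𝔹' ℓ r₁` — transversal action, COERCIVITY from `NearIso 𝔹'`,
# operator norm, linearity in the tensor (helper; `--kind proof --supports stmt-AnomalousDissipation-27980 --as helper`)

Summits-side helper file of route `SolenoidalFractalHomogenisation` (prover seat `ad-k1l-cellLawV-w1` g7; 0 sorry, no defs, no named facts).  The `Ḡ` of
`…SidebandXSlowAveraging.norm_modeRep_sub_exp_le` for the effective tensor `𝔹'`: `effGenC 𝔹' ℓ r₁ = (4π²P_ℓT_{𝔹'ᵀ}(ℓ)P_ℓ)↾ℝ + r₁(1 − P_ℓ)↾ℝ`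
(`…SidebandXEffGenDefs`).  Cell finding F-w1g7-1 / ruling D27-1: the coercivity RATE is `4π²·lo'·|ℓ|²` with `lo'` the `NearIso` lower constant of `𝔹'`
— for `𝔹' = (1/n²)(𝔸 + (1/ν)psiStar)` this is where the quantitative ellipticity of `psiStar` enters.
* `modalAdjGen_add_tensor`, `modalAdjGen_smul_tensor` — linearity of `𝔸 ↦ 4π²P_kT_𝔸(k)` in the tensor;
* `effGenC_apply_of_transversal` — `effGenC 𝔹' ℓ r₁ v = 4π²P_ℓT_{𝔹'ᵀ}(ℓ) v` for `P_ℓ v = v`;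
* `real_inner_effGenC` — `⟪effGenC v, v⟫_ℝ = Re⟪4π²P_ℓT_{𝔹'ᵀ}P_ℓ v, P_ℓ v⟫ + r₁(‖v‖² − ‖P_ℓv‖²)`;
* **`effGenC_coercive`** — `NearIso 𝔹' lo' hi'`, `lo' ≥ 0`, `r₁ = 4π²lo'|ℓ|²` ⇒ `4π²lo'|ℓ|²·‖v‖² ≤ ⟪effGenC 𝔹' ℓ r₁ v, v⟫_ℝ` for ALL `v ∈ ℂ³`;
* `norm_effGenC_le` — `‖effGenC 𝔹' ℓ r₁‖ ≤ 4π²(hi' + β'/2)|ℓ|² + 2|r₁|` (`OddSmall 𝔹' β'`).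
NOT a proof of any registered stub, of K1L_D, or of anomalous dissipation; rung F-D1.A0 infrastructure.
-/

set_option linter.dupNamespace false

noncomputable section

namespace Summit.AnomalousDissipation.AnomalousDissipation.Theorems.SolenoidalFractalHomogenisation.LagrangianStep.Sideband

open Set MeasureTheory Complex UnitAddTorus
open scoped InnerProductSpace
open Literature.Analysis Literature.Analysis.FunctionSpaces Literature.Analysis.FunctionSpaces.Torus
open Literature.Analysis.FluidPDE Literature.Analysis.FluidPDE.Torus Literature.Analysis.FluidPDE.LatticeShear
open Summit.AnomalousDissipation.AnomalousDissipation.Theorems.SolenoidalFractalHomogenisation.LagrangianStep.CellChain (norm_transversalProj_le)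

/-! ## §1 Linearity of the modal generator in the tensor -/

/-- `L_k(𝔸 + 𝔹) = L_k(𝔸) + L_k(𝔹)`. [cite: Frisch1995Turbulence, §9.6.3 eq. (9.57) p. 233] -/
theorem modalAdjGen_add_tensor (𝔸 𝔹 : Torus.Visc4 (Fin 3)) (k : Fin 3 → ℤ) (z : EuclideanSpace ℂ (Fin 3)) :
    Torus.modalAdjGen (𝔸 + 𝔹) k z = Torus.modalAdjGen 𝔸 k z + Torus.modalAdjGen 𝔹 k z := by
  rw [Torus.modalAdjGen_apply, Torus.modalAdjGen_apply, Torus.modalAdjGen_apply, Torus.symbT_add_tensor, map_add, smul_add]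

/-- `L_k(r • 𝔸) = r • L_k(𝔸)`. [cite: Frisch1995Turbulence, §9.6.3 eq. (9.57) p. 233] -/
theorem modalAdjGen_smul_tensor (r : ℝ) (𝔸 : Torus.Visc4 (Fin 3)) (k : Fin 3 → ℤ) (z : EuclideanSpace ℂ (Fin 3)) :
    Torus.modalAdjGen (r • 𝔸) k z = (r : ℂ) • Torus.modalAdjGen 𝔸 k z := by
  rw [Torus.modalAdjGen_apply, Torus.modalAdjGen_apply, Torus.symbT_smul_tensor, map_smul, smul_comm]

/-- `L_k((𝔸 + 𝔹)ᵀ) = L_k(𝔸ᵀ) + L_k(𝔹ᵀ)`. [cite: Frisch1995Turbulence, §9.6.3 eq. (9.57) p. 233] -/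
theorem modalAdjGen_majorTranspose_add (𝔸 𝔹 : Torus.Visc4 (Fin 3)) (k : Fin 3 → ℤ) (z : EuclideanSpace ℂ (Fin 3)) :
    Torus.modalAdjGen (Torus.majorTranspose (𝔸 + 𝔹)) k z =
      Torus.modalAdjGen (Torus.majorTranspose 𝔸) k z + Torus.modalAdjGen (Torus.majorTranspose 𝔹) k z := by
  rw [Torus.majorTranspose_add, modalAdjGen_add_tensor]

/-- `L_k((r • 𝔸)ᵀ) = r • L_k(𝔸ᵀ)`. [cite: Frisch1995Turbulence, §9.6.3 eq. (9.57) p. 233] -/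
theorem modalAdjGen_majorTranspose_smul (r : ℝ) (𝔸 : Torus.Visc4 (Fin 3)) (k : Fin 3 → ℤ) (z : EuclideanSpace ℂ (Fin 3)) :
    Torus.modalAdjGen (Torus.majorTranspose (r • 𝔸)) k z = (r : ℂ) • Torus.modalAdjGen (Torus.majorTranspose 𝔸) k z := by
  rw [Torus.majorTranspose_smul, modalAdjGen_smul_tensor]

/-! ## §2 The augmented generator: transversal action, energy, coercivity, norm -/

/-- **On transversal vectors the augmentation is idle**: `P_ℓ v = v → effGenC 𝔹' ℓ r₁ v = 4π²P_ℓT_{𝔹'ᵀ}(ℓ) v`.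
[cite: MajdaKramer1999, §2.2.1.3 (55)] -/
theorem effGenC_apply_of_transversal (𝔹' : Torus.Visc4 (Fin 3)) (ℓ : Fin 3 → ℤ) (r₁ : ℝ) {v : EuclideanSpace ℂ (Fin 3)}
    (hv : transversalProj ℓ v = v) :
    effGenC 𝔹' ℓ r₁ v = Torus.modalAdjGen (Torus.majorTranspose 𝔹') ℓ v := by
  rw [effGenC_apply, hv, sub_self, smul_zero, add_zero]

/-- **Energy identity**: `⟪effGenC v, v⟫_ℝ = Re⟪4π²P_ℓT_{𝔹'ᵀ}(ℓ)(P_ℓ v), P_ℓ v⟫ + r₁(‖v‖² − ‖P_ℓ v‖²)`. [cite: MajdaKramer1999, §2.2.1.3 (55)] -/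
theorem real_inner_effGenC (𝔹' : Torus.Visc4 (Fin 3)) (ℓ : Fin 3 → ℤ) (r₁ : ℝ) (v : EuclideanSpace ℂ (Fin 3)) :
    ⟪effGenC 𝔹' ℓ r₁ v, v⟫_ℝ =
      (⟪Torus.modalAdjGen (Torus.majorTranspose 𝔹') ℓ (transversalProj ℓ v), transversalProj ℓ v⟫_ℂ).re + r₁ * (‖v‖ ^ 2 - ‖transversalProj ℓ v‖ ^ 2) := by
  have hri : ∀ x z : EuclideanSpace ℂ (Fin 3), ⟪x, z⟫_ℝ = (⟪x, z⟫_ℂ).re := fun x z => real_inner_eq_re_inner ℂ x z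
  rw [hri, effGenC_apply, inner_add_left, Complex.add_re]
  congr 1
  · -- `⟪L(Pv), v⟫ = ⟪L(Pv), Pv⟫` since `L(Pv) = P(…)`
    rw [Torus.modalAdjGen_apply, inner_smul_left, inner_smul_left, inner_transversalProj_eq_inner_transversalProj]
  · rw [← Complex.coe_smul, inner_smul_left, Complex.conj_ofReal, Complex.re_ofReal_mul, re_inner_sub_transversalProj]

/-- **COERCIVITY OF THE AUGMENTED EFFECTIVE GENERATOR**: `NearIso 𝔹' lo' hi'`, `lo' ≥ 0` ⇒ with `r₁ := 4π²·lo'·|ℓ|²`,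
`4π²·lo'·|ℓ|²·‖v‖² ≤ ⟪effGenC 𝔹' ℓ r₁ v, v⟫_ℝ` for every `v ∈ ℂ³`. [cite: Frisch1995Turbulence, §9.6.3 eq. (9.57) p. 233]
[cite: Giaquinta1983MultipleIntegrals, Ch. III §2 eq. (2.2)] -/
theorem effGenC_coercive {𝔹' : Torus.Visc4 (Fin 3)} {lo' hi' : ℝ} (h𝔹 : Torus.NearIso 𝔹' lo' hi') (hlo' : 0 ≤ lo') (ℓ : Fin 3 → ℤ)
    (v : EuclideanSpace ℂ (Fin 3)) :
    4 * Real.pi ^ 2 * lo' * freqNormSq ℓ * ‖v‖ ^ 2 ≤ ⟪effGenC 𝔹' ℓ (4 * Real.pi ^ 2 * lo' * freqNormSq ℓ) v, v⟫_ℝ := by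
  rw [real_inner_effGenC]
  have hT : Torus.NearIso (Torus.majorTranspose 𝔹') lo' hi' := (Torus.nearIso_majorTranspose_iff 𝔹' lo' hi').2 h𝔹
  have hw : kdot ℓ (transversalProj ℓ v) = 0 := CellChain.kdot_transversalProj' ℓ v
  have h1 := ThreeMode.re_inner_modalAdjGen_ge hT ℓ hw
  have hP : ‖transversalProj ℓ v‖ ^ 2 ≤ ‖v‖ ^ 2 := pow_le_pow_left₀ (norm_nonneg _) (norm_transversalProj_le ℓ v) 2
  have hc : 0 ≤ 4 * Real.pi ^ 2 * lo' * freqNormSq ℓ := by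
    have := freqNormSq_nonneg ℓ; positivity
  nlinarith [h1, hP, hc, mul_nonneg hc (sub_nonneg.2 hP)]

/-- **Operator norm**: `‖effGenC 𝔹' ℓ r₁‖ ≤ 4π²(hi' + β'/2)|ℓ|² + 2|r₁|` (`NearIso 𝔹' lo' hi'`, `lo', hi' ≥ 0`, `OddSmall 𝔹' β'`, `β' ≥ 0`).
[cite: Frisch1995Turbulence, §9.6.3 eq. (9.57) p. 233] -/
theorem norm_effGenC_le {𝔹' : Torus.Visc4 (Fin 3)} {lo' hi' β' : ℝ} (h𝔹 : Torus.NearIso 𝔹' lo' hi') (hlo' : 0 ≤ lo') (hhi' : 0 ≤ hi')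
    (hodd : Torus.OddSmall 𝔹' β') (hβ' : 0 ≤ β') (ℓ : Fin 3 → ℤ) (r₁ : ℝ) :
    ‖effGenC 𝔹' ℓ r₁‖ ≤ 4 * Real.pi ^ 2 * (hi' + β' / 2) * freqNormSq ℓ + 2 * |r₁| := by
  have hT : Torus.NearIso (Torus.majorTranspose 𝔹') lo' hi' := (Torus.nearIso_majorTranspose_iff 𝔹' lo' hi').2 h𝔹
  have hoddT : Torus.OddSmall (Torus.majorTranspose 𝔹') β' := hodd.majorTranspose
  have hC : 0 ≤ 4 * Real.pi ^ 2 * (hi' + β' / 2) * freqNormSq ℓ + 2 * |r₁| := by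
    have := freqNormSq_nonneg ℓ; positivity
  refine ContinuousLinearMap.opNorm_le_bound _ hC fun v => ?_
  rw [effGenC_apply]
  have hw : kdot ℓ (transversalProj ℓ v) = 0 := CellChain.kdot_transversalProj' ℓ v
  have h1 := ThreeMode.norm_modalAdjGen_le hT hlo' hhi' hoddT hβ' ℓ (transversalProj ℓ v) hw
  have hPv := norm_transversalProj_le ℓ v
  have h2 : ‖r₁ • (v - transversalProj ℓ v)‖ ≤ 2 * |r₁| * ‖v‖ := by
    rw [norm_smul, Real.norm_eq_abs]
    have : ‖v - transversalProj ℓ v‖ ≤ 2 * ‖v‖ := (norm_sub_le _ _).trans (by linarith)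
    nlinarith [abs_nonneg r₁]
  have h1' : ‖Torus.modalAdjGen (Torus.majorTranspose 𝔹') ℓ (transversalProj ℓ v)‖ ≤ 4 * Real.pi ^ 2 * (hi' + β' / 2) * freqNormSq ℓ * ‖v‖ := by
    refine h1.trans (mul_le_mul_of_nonneg_left hPv ?_)
    have := freqNormSq_nonneg ℓ; positivity
  calc ‖Torus.modalAdjGen (Torus.majorTranspose 𝔹') ℓ (transversalProj ℓ v) + r₁ • (v - transversalProj ℓ v)‖
      ≤ ‖Torus.modalAdjGen (Torus.majorTranspose 𝔹') ℓ (transversalProj ℓ v)‖ + ‖r₁ • (v - transversalProj ℓ v)‖ := norm_add_le _ _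
    _ ≤ _ := by linarith

end Summit.AnomalousDissipation.AnomalousDissipation.Theorems.SolenoidalFractalHomogenisation.LagrangianStep.Sideband

end
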